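import Mathlib
import Summits.Ventures.HodgeRepro2.Tier7.Line3.SchurProjector
import Summits.Ventures.HodgeRepro2.Tier7.Line3.FiniteRankAdjoint
import Summits.Ventures.HodgeRepro2.T7SupportSpectralSide

/-!
# Tier7/Line3/TwoVectorPeriod — the two-vector coefficient: rank-one map, its adjoint, its double period
(seat t7-L1-p4, gen 3)

LINE 3 (t7-plan-3), version (ii), memo v15 §2g′ (1) (STATUS l. 15352; crit-2 l. 15359): the line's test function is
the TWO-vector coefficient `f_v(g) = d · conj ⟨π⁰_v(g) u_B, u_A⟩` (`u_A` the `(T_A, μ_A)`-weight vector, `u_B = π⁰_v(h) u_A`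
the `(T_B, μ_B)`-weight vector), for which `f* ≠ f`; the spectral side per copy of `π⁰_v` is
`∑_φ ⟨φ, u_B⟩ P_A(u_A) conj P_B(φ) = P_A(u_A) · conj P_B(u_B)` — each period on its own weight vector — and the kernel
identity runs on `FiniteRankAdjoint` p675501 (no self-adjointness). THIS FILE types that paragraph in the abstract:

* **the double period is basis-free** (`doublePeriod T P Q := P (T q_Q)`, `q_Q` the Riesz vector of the B-period `Q`):
  `∑ i, P (T (e i)) · conj (Q (e i)) = doublePeriod T P Q` for EVERY orthonormal basis `e` of the finite-dimensional
  carrier (`sum_apply_mul_conj`) — the double period `∫_A ∫_B` of the kernel `∑ i, (T e_i)(x) · conj e_i(y)`; this is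
  the functional form of p1's row 664 `T7SupportSpectralSide.inner_apply_eq_sum` (the Riesz-vector form
  `⟪R v_B, v_A⟫ = ∑ i, ⟪R (b i), v_A⟫ · ⟪v_B, b i⟫`), DERIVED from it, not re-proved; and
  `∑ j, P (b j) · conj (Q (T† (b j))) = doublePeriod T P Q` for every orthonormal basis `b` of the RANGE of `T`
  (`sum_range_basis_mul_conj_adjoint`, through `FiniteRankAdjoint.apply_eq_sum_adjoint`) — the `(ψ_i, φ_i) = (b_i, T† b_i)`
  kernel of p675501 has the same double period: the two kernel shapes of the identity side agree;
* **the rank-one map** `SchurProjector.rankOne a x : v ↦ ⟪a, v⟫ • x` (`u_B ↦ u_A`): its adjoint is the rank-one map with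
  the vectors swapped (`adjoint_rankOne`), its double period is `P x · conj (Q a)` (`doublePeriod_rankOne`), non-zero iff
  `P x ≠ 0 ∧ Q a ≠ 0` (`doublePeriod_rankOne_ne_zero_iff`);
* **at the compact place** (`G` compact, `μ` a left-invariant probability measure, `τ` a continuous irreducible unitary
  representation on the finite-dimensional `V`): `twoVectorOp μ τ uB uA v := d • ∫ ⟪τ g uB, uA⟫ • τ g v ∂μ` is `R(f_v) v`
  for `f_v(g) = d · ⟪τ g uB, uA⟫` (`coeff`; Mathlib's inner product is conjugate-linear in the FIRST slot, so this is the
  classical `d · conj ⟨τ(g) u_B, u_A⟩`, the memo's `f_v`); `twoVectorOp_eq : R(f_v) v = ⟪uB, v⟫ • uA` (Schur orthogonality,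
  `SchurProjector.integral_inner_smul_apply` with `a = u_B`, `x = u_A`), `twoVectorOpOn_eq_zero` (`R(f_v) = 0` on every
  irreducible `σ ≇ τ`), `conj_coeff_inv : f*(g) = conj (f g⁻¹)` is the coefficient with the vectors SWAPPED, and
  `adjoint_rankOne_eq_twoVectorOp : R(f)† = R(f*)`; **`doublePeriod_twoVectorOp`**:
  `∑ i, P_A (R(f_v) (e i)) · conj (P_B (e i)) = P_A uA · conj (P_B uB)`, **`doublePeriod_twoVectorOp_ne_zero_iff`**, and
  `apply_twoVectorOp : P_A (R(f_v) v) = ⟪uB, v⟫ · P_A uA`.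

What stays in words: the dictionary (`U(W_A)(F_{ι₁})`, `τ`, `u_A`, `u_B = τ(h) u_A`, the period functionals on a copy), the
isotypic decomposition of the level-`K_f` forms into copies (printed), and INPUT G at `ι₂`, `ι₃` (crit-2 l. 15359 record (c)).
Nothing here is about an adelic group, a period of an automorphic form, or (N); no device. No sorry;
axioms ⊆ {propext, Classical.choice, Quot.sound}.
-/

namespace Summit.Ventures.HodgeRepro2.Tier7.Line3.TwoVectorPeriod

open MeasureTheory
open scoped InnerProductSpace
open Summit.Ventures.HodgeRepro2.Tier7.Line3

section DoublePeriod

variable {V : Type*} [NormedAddCommGroup V] [InnerProductSpace ℂ V] [CompleteSpace V]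

/-- the Riesz vector of a continuous functional: `Q v = ⟪rieszVec Q, v⟫`. -/
noncomputable def rieszVec (Q : V →L[ℂ] ℂ) : V := (InnerProductSpace.toDual ℂ V).symm Q

/-- `⟪rieszVec Q, v⟫ = Q v`. -/
theorem inner_rieszVec (Q : V →L[ℂ] ℂ) (v : V) : ⟪rieszVec Q, v⟫_ℂ = Q v :=
  InnerProductSpace.toDual_symm_apply

/-- `conj (Q v) = ⟪v, rieszVec Q⟫`. -/
theorem conj_apply_eq_inner_rieszVec (Q : V →L[ℂ] ℂ) (v : V) :
    (starRingEnd ℂ) (Q v) = ⟪v, rieszVec Q⟫_ℂ := by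
  rw [← inner_rieszVec Q v, inner_conj_symm]

/-- **the double period** of a bounded operator `T` against the A-period `P` and the B-period `Q`: `P (T q_Q)`,
`q_Q` the Riesz vector of `Q` — the basis-free value of `∑ i, P (T e_i) · conj (Q e_i)`. -/
noncomputable def doublePeriod (T : V →L[ℂ] V) (P Q : V →L[ℂ] ℂ) : ℂ := P (T (rieszVec Q))

/-- **the double period is basis-free**: for every orthonormal basis `e` of the finite-dimensional carrier,
`∑ i, P (T (e i)) · conj (Q (e i)) = doublePeriod T P Q`. -/
theorem sum_apply_mul_conj {ι : Type*} [Fintype ι] (e : OrthonormalBasis ι ℂ V) (T : V →L[ℂ] V)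
    (P Q : V →L[ℂ] ℂ) :
    ∑ i, P (T (e i)) * (starRingEnd ℂ) (Q (e i)) = doublePeriod T P Q := by
  unfold doublePeriod
  -- p1's row 664 with `R = T`, `v_A = q_P`, `v_B = q_Q`: `⟪T q_Q, q_P⟫ = ∑ i, ⟪T (e i), q_P⟫ * ⟪q_Q, e i⟫`
  have h := T7SupportSpectralSide.inner_apply_eq_sum e (T : V →ₗ[ℂ] V) (rieszVec P) (rieszVec Q)
  simp only [ContinuousLinearMap.coe_coe] at h
  conv_rhs => rw [← inner_rieszVec P, ← inner_conj_symm]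
  rw [h, map_sum]
  refine Finset.sum_congr rfl fun i _ => ?_
  rw [map_mul, inner_conj_symm, inner_conj_symm, inner_rieszVec, ← conj_apply_eq_inner_rieszVec]

/-- **the `(b, T† b)` kernel of `FiniteRankAdjoint` has the same double period**: for every orthonormal basis `b` of the
range of `T`, `∑ j, P (b j) · conj (Q (T† (b j))) = doublePeriod T P Q`. -/
theorem sum_range_basis_mul_conj_adjoint {ι : Type*} [Fintype ι] (T : V →L[ℂ] V)
    (b : OrthonormalBasis ι ℂ (T7SupportFiniteRankSelfAdjoint.range T)) (P Q : V →L[ℂ] ℂ) :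
    ∑ j, P (b j : V) * (starRingEnd ℂ) (Q (ContinuousLinearMap.adjoint T (b j : V))) = doublePeriod T P Q := by
  unfold doublePeriod
  rw [FiniteRankAdjoint.apply_eq_sum_adjoint T b (rieszVec Q), map_sum]
  refine Finset.sum_congr rfl fun j _ => ?_
  rw [map_smul, smul_eq_mul, conj_apply_eq_inner_rieszVec, mul_comm]

/-- the adjoint of the rank-one map `v ↦ ⟪a, v⟫ • x` is the rank-one map with the vectors swapped, `v ↦ ⟪x, v⟫ • a`. -/
theorem adjoint_rankOne (a x : V) :
    ContinuousLinearMap.adjoint (SchurProjector.rankOne a x) = SchurProjector.rankOne x a := by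
  symm
  rw [ContinuousLinearMap.eq_adjoint_iff]
  intro u v
  simp only [SchurProjector.rankOne_apply, inner_smul_left, inner_smul_right, inner_conj_symm]
  ring

/-- **the double period of the rank-one map** `v ↦ ⟪a, v⟫ • x` is `P x · conj (Q a)` — the A-period of `x` times the
conjugate B-period of `a`. -/
theorem doublePeriod_rankOne (a x : V) (P Q : V →L[ℂ] ℂ) :
    doublePeriod (SchurProjector.rankOne a x) P Q = P x * (starRingEnd ℂ) (Q a) := by
  unfold doublePeriod
  rw [SchurProjector.rankOne_apply, map_smul, smul_eq_mul, conj_apply_eq_inner_rieszVec, mul_comm]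

/-- the double period of the rank-one map is non-zero iff both periods are: `P x ≠ 0 ∧ Q a ≠ 0`. -/
theorem doublePeriod_rankOne_ne_zero_iff (a x : V) (P Q : V →L[ℂ] ℂ) :
    doublePeriod (SchurProjector.rankOne a x) P Q ≠ 0 ↔ P x ≠ 0 ∧ Q a ≠ 0 := by
  rw [doublePeriod_rankOne, mul_ne_zero_iff]
  simp only [ne_eq, map_eq_zero]

/-- the same over an orthonormal basis of the carrier: `∑ i, P (⟪a, e i⟫ • x) · conj (Q (e i)) = P x · conj (Q a)`. -/
theorem sum_rankOne_mul_conj {ι : Type*} [Fintype ι] (e : OrthonormalBasis ι ℂ V) (a x : V)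
    (P Q : V →L[ℂ] ℂ) :
    ∑ i, P (SchurProjector.rankOne a x (e i)) * (starRingEnd ℂ) (Q (e i)) = P x * (starRingEnd ℂ) (Q a) := by
  rw [sum_apply_mul_conj e, doublePeriod_rankOne]

end DoublePeriod

section Coefficient

variable {G : Type*} [Group G]
variable {V : Type*} [NormedAddCommGroup V] [InnerProductSpace ℂ V]

/-- the two-vector coefficient `f(g) = d · ⟪τ g uB, uA⟫` (= the classical `d · conj ⟨τ(g) u_B, u_A⟩`). -/
noncomputable def coeff (τ : G →* (V →L[ℂ] V)) (uB uA : V) (g : G) : ℂ :=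
  (Module.finrank ℂ V : ℂ) * ⟪τ g uB, uA⟫_ℂ

/-- **`f*` is the coefficient with the vectors swapped**: `conj (f g⁻¹) = d · ⟪τ g uA, uB⟫` for unitary `τ`. -/
theorem conj_coeff_inv (τ : G →* (V →L[ℂ] V)) (hτu : SchurProjector.IsUnitaryRep τ) (uB uA : V) (g : G) :
    (starRingEnd ℂ) (coeff τ uB uA g⁻¹) = coeff τ uA uB g := by
  unfold coeff
  rw [map_mul, map_natCast, inner_conj_symm, SchurProjector.inner_apply_inv τ hτu]

/-- the integrated two-vector coefficient: `R(f) v = d • ∫ ⟪τ g uB, uA⟫ • τ g v ∂μ`. -/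
noncomputable def twoVectorOp [MeasurableSpace G] (μ : Measure G) (τ : G →* (V →L[ℂ] V)) (uB uA v : V) : V :=
  (Module.finrank ℂ V : ℂ) • ∫ g, ⟪τ g uB, uA⟫_ℂ • τ g v ∂μ

/-- `R(f) v = ∫ f(g) • τ g v ∂μ` with `f = coeff τ uB uA`. -/
theorem twoVectorOp_eq_integral_coeff [MeasurableSpace G] (μ : Measure G) (τ : G →* (V →L[ℂ] V))
    (uB uA v : V) :
    twoVectorOp μ τ uB uA v = ∫ g, coeff τ uB uA g • τ g v ∂μ := by
  unfold twoVectorOp coeff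
  rw [← integral_smul]
  refine integral_congr_ae (Filter.Eventually.of_forall fun g => ?_)
  simp only [smul_smul]

end Coefficient

section CompactPlace

variable {G : Type*} [Group G] [TopologicalSpace G] [IsTopologicalGroup G] [CompactSpace G] [MeasurableSpace G]
  [BorelSpace G]
variable {V : Type*} [NormedAddCommGroup V] [InnerProductSpace ℂ V]

/-- **`R(f) v = ⟪uB, v⟫ • uA`** — the integrated two-vector coefficient is the rank-one map `u_B ↦ u_A` on the
`τ`-space (τ irreducible unitary; Schur orthogonality). -/
theorem twoVectorOp_eq [FiniteDimensional ℂ V] [CompleteSpace V] (μ : Measure G) [IsProbabilityMeasure μ]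
    [μ.IsMulLeftInvariant] (τ : G →* (V →L[ℂ] V)) (hτ : Continuous τ) (hτu : SchurProjector.IsUnitaryRep τ)
    (hτi : SchurProjector.IsIrreducible τ) (uB uA v : V) :
    twoVectorOp μ τ uB uA v = ⟪uB, v⟫_ℂ • uA := by
  unfold twoVectorOp
  rw [SchurProjector.integral_inner_smul_apply μ τ hτ hτu hτi, smul_smul]
  haveI := hτi.nontrivial
  have hd0 : (Module.finrank ℂ V : ℂ) ≠ 0 := by
    exact_mod_cast (Module.finrank_pos (R := ℂ) (M := V)).ne'
  rw [mul_inv_cancel_left₀ hd0]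

/-- the operator form: `R(f) v = rankOne uB uA v`. -/
theorem twoVectorOp_eq_rankOne [FiniteDimensional ℂ V] [CompleteSpace V] (μ : Measure G) [IsProbabilityMeasure μ]
    [μ.IsMulLeftInvariant] (τ : G →* (V →L[ℂ] V)) (hτ : Continuous τ) (hτu : SchurProjector.IsUnitaryRep τ)
    (hτi : SchurProjector.IsIrreducible τ) (uB uA v : V) :
    twoVectorOp μ τ uB uA v = SchurProjector.rankOne uB uA v := by
  rw [twoVectorOp_eq μ τ hτ hτu hτi, SchurProjector.rankOne_apply]

/-- **`R(f)† = R(f*)`**: the adjoint of the integrated coefficient (the rank-one map `u_B ↦ u_A`) is the integrated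
SWAPPED coefficient, `v ↦ ⟪uA, v⟫ • uB`. -/
theorem adjoint_rankOne_eq_twoVectorOp [FiniteDimensional ℂ V] [CompleteSpace V] (μ : Measure G)
    [IsProbabilityMeasure μ] [μ.IsMulLeftInvariant] (τ : G →* (V →L[ℂ] V)) (hτ : Continuous τ)
    (hτu : SchurProjector.IsUnitaryRep τ) (hτi : SchurProjector.IsIrreducible τ) (uB uA v : V) :
    ContinuousLinearMap.adjoint (SchurProjector.rankOne uB uA) v = twoVectorOp μ τ uA uB v := by
  rw [adjoint_rankOne, twoVectorOp_eq μ τ hτ hτu hτi, SchurProjector.rankOne_apply]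

/-- the same integral against another representation `σ`: `d • ∫ ⟪τ g uB, uA⟫ • σ g v`. -/
noncomputable def twoVectorOpOn {W : Type*} [NormedAddCommGroup W] [InnerProductSpace ℂ W] (μ : Measure G)
    (τ : G →* (V →L[ℂ] V)) (uB uA : V) (σ : G →* (W →L[ℂ] W)) (v : W) : W :=
  (Module.finrank ℂ V : ℂ) • ∫ g, ⟪τ g uB, uA⟫_ℂ • σ g v ∂μ

/-- **`R(f)` kills every irreducible `σ ≇ τ`**: `d • ∫ ⟪τ g uB, uA⟫ • σ g v = 0`. -/
theorem twoVectorOpOn_eq_zero {W : Type*} [NormedAddCommGroup W] [InnerProductSpace ℂ W] [CompleteSpace W]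
    (μ : Measure G) [IsProbabilityMeasure μ] [μ.IsMulLeftInvariant] (τ : G →* (V →L[ℂ] V)) (hτ : Continuous τ)
    (hτu : SchurProjector.IsUnitaryRep τ) (hτi : SchurProjector.IsIrreducible τ) (uB uA : V)
    (σ : G →* (W →L[ℂ] W)) (hσ : Continuous σ) (hσi : SchurProjector.IsIrreducible σ)
    (hne : ¬ SchurProjector.IsEquivIso σ τ) (v : W) : twoVectorOpOn μ τ uB uA σ v = 0 := by
  unfold twoVectorOpOn
  rw [SchurProjector.integral_inner_smul_apply_eq_zero μ σ τ hσ hτ hτu hσi hτi hne uB v uA, smul_zero]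

/-- `P_A (R(f) v) = ⟪uB, v⟫ · P_A uA`: the A-period of `R(f) v` is the `u_B`-coefficient of `v` times the A-period
of `u_A`. -/
theorem apply_twoVectorOp [FiniteDimensional ℂ V] [CompleteSpace V] (μ : Measure G) [IsProbabilityMeasure μ]
    [μ.IsMulLeftInvariant] (τ : G →* (V →L[ℂ] V)) (hτ : Continuous τ) (hτu : SchurProjector.IsUnitaryRep τ)
    (hτi : SchurProjector.IsIrreducible τ) (PA : V →L[ℂ] ℂ) (uB uA v : V) :
    PA (twoVectorOp μ τ uB uA v) = ⟪uB, v⟫_ℂ * PA uA := by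
  rw [twoVectorOp_eq μ τ hτ hτu hτi, map_smul, smul_eq_mul]

/-- **the double period of `R(f)` on the `τ`-copy**: for every orthonormal basis `e` of the carrier,
`∑ i, P_A (R(f) (e i)) · conj (P_B (e i)) = P_A uA · conj (P_B uB)` — each period on its own weight vector. -/
theorem doublePeriod_twoVectorOp [FiniteDimensional ℂ V] [CompleteSpace V] (μ : Measure G)
    [IsProbabilityMeasure μ] [μ.IsMulLeftInvariant] (τ : G →* (V →L[ℂ] V)) (hτ : Continuous τ)
    (hτu : SchurProjector.IsUnitaryRep τ) (hτi : SchurProjector.IsIrreducible τ) {ι : Type*} [Fintype ι]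
    (e : OrthonormalBasis ι ℂ V) (PA PB : V →L[ℂ] ℂ) (uB uA : V) :
    ∑ i, PA (twoVectorOp μ τ uB uA (e i)) * (starRingEnd ℂ) (PB (e i)) = PA uA * (starRingEnd ℂ) (PB uB) := by
  have h : ∀ i, twoVectorOp μ τ uB uA (e i) = SchurProjector.rankOne uB uA (e i) := fun i =>
    twoVectorOp_eq_rankOne μ τ hτ hτu hτi uB uA (e i)
  simp_rw [h]
  exact sum_rankOne_mul_conj e uB uA PA PB

/-- the double period of `R(f)` on the copy is basis-free: it is `doublePeriod (rankOne uB uA) P_A P_B`. -/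
theorem sum_twoVectorOp_eq_doublePeriod [FiniteDimensional ℂ V] [CompleteSpace V] (μ : Measure G)
    [IsProbabilityMeasure μ] [μ.IsMulLeftInvariant] (τ : G →* (V →L[ℂ] V)) (hτ : Continuous τ)
    (hτu : SchurProjector.IsUnitaryRep τ) (hτi : SchurProjector.IsIrreducible τ) {ι : Type*} [Fintype ι]
    (e : OrthonormalBasis ι ℂ V) (PA PB : V →L[ℂ] ℂ) (uB uA : V) :
    ∑ i, PA (twoVectorOp μ τ uB uA (e i)) * (starRingEnd ℂ) (PB (e i)) =
      doublePeriod (SchurProjector.rankOne uB uA) PA PB := by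
  rw [doublePeriod_twoVectorOp μ τ hτ hτu hτi e PA PB uB uA, doublePeriod_rankOne]

/-- the `(b, T† b)` shape of `FiniteRankAdjoint` for `T = R(f) = rankOne uB uA`: for every orthonormal basis `b` of
the range, `∑ j, P_A (b j) · conj (P_B (T† (b j))) = P_A uA · conj (P_B uB)`. -/
theorem sum_range_basis_twoVector [CompleteSpace V] {ι : Type*} [Fintype ι] (uB uA : V)
    (b : OrthonormalBasis ι ℂ (T7SupportFiniteRankSelfAdjoint.range (SchurProjector.rankOne uB uA)))
    (PA PB : V →L[ℂ] ℂ) :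
    ∑ j, PA (b j : V) *
        (starRingEnd ℂ) (PB (ContinuousLinearMap.adjoint (SchurProjector.rankOne uB uA) (b j : V))) =
      PA uA * (starRingEnd ℂ) (PB uB) := by
  rw [sum_range_basis_mul_conj_adjoint, doublePeriod_rankOne]

/-- **the RTF conclusion on a copy**: the double period of `R(f)` is non-zero iff `P_A uA ≠ 0` and `P_B uB ≠ 0`. -/
theorem doublePeriod_twoVectorOp_ne_zero_iff [FiniteDimensional ℂ V] [CompleteSpace V] (μ : Measure G)
    [IsProbabilityMeasure μ] [μ.IsMulLeftInvariant] (τ : G →* (V →L[ℂ] V)) (hτ : Continuous τ)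
    (hτu : SchurProjector.IsUnitaryRep τ) (hτi : SchurProjector.IsIrreducible τ) {ι : Type*} [Fintype ι]
    (e : OrthonormalBasis ι ℂ V) (PA PB : V →L[ℂ] ℂ) (uB uA : V) :
    (∑ i, PA (twoVectorOp μ τ uB uA (e i)) * (starRingEnd ℂ) (PB (e i))) ≠ 0 ↔ PA uA ≠ 0 ∧ PB uB ≠ 0 := by
  rw [sum_twoVectorOp_eq_doublePeriod μ τ hτ hτu hτi e PA PB uB uA, doublePeriod_rankOne_ne_zero_iff]

end CompactPlace

end Summit.Ventures.HodgeRepro2.Tier7.Line3.TwoVectorPeriod
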